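import Summits.BirchSwinnertonDyer.BirchSwinnertonDyer.Theorems.GenusKolyvaginAtTwoShaCorestrictionLocalTriviality
import HarnessLib

/-!
# Route `GenusKolyvaginAtTwo` — corestriction maps `Ш(E_L/L)` into `Ш(E/F)` over ANY base number field `F`
# (`L/F` finite Galois; the model pair `(rangeToResGal, ψ)`)

Seat `bsd-line-gk2-p4` g28 (cell `bsd-f1-sign2`).  Sequel of `…ShaCorestrictionLocalTriviality` (§4 there is already stated for a
general base `F`; §5–§6 there specialise to `F = ℚ` and the tree's model map `galH1Model`).  Here §5–§6 for a GENERAL base number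
field `F`, with the model map written as `resH1Hom (rangeToResGal L) ψ hψ` for any coefficient map `ψ : E_L(L̄) → E(F̄)` inverse to
`θ = localPointsEquivGeomPoints ∘ pointsMap` (`hψspec`) — e.g. for base-change arguments over `ℚ(i)` / `ℚ(√−3)` towers:

* `resH1Hom_conjH1_model_eq_zero_adicCompletion` / `_infinitePlace` — the `g_*` form at the chosen embedding (every `g ∈ Γ_F`);
* ★ `coresH1_model_mem_localRestrictionKer_adicCompletion` / `_infinitePlace`, ★ `coresH1_model_mem_sha` —
  `cores (res_{(rangeToResGal, ψ)} x) ∈ Ш(E/F)` for `x ∈ Ш(E_L/L)` (Clark–Sharif local triviality `resH1Hom_coresH1_eq_zero`).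

THEOREMS ONLY; no definition, no named fact, no `sorry`.  BSD is NOT proved by this file; nothing is closed by it.

References: [MilneADT2006] I.§6 Rem. 6.10; [NeukirchSchmidtWingberg2008] I.§5; [ClarkSharif2010] §3.6; [SerreGaloisCohomology1997] II.§1.1.
-/

set_option autoImplicit false
set_option linter.dupNamespace false -- `Summit.<P>.<Sub>` repeats `BirchSwinnertonDyer` (D-0017)

noncomputable section

open scoped Classical

universe u

namespace Summit.BirchSwinnertonDyer.BirchSwinnertonDyer.Theorems.GenusExact.ShaCores

open WeierstrassCurve NumberField IsDedekindDomain Literature.NumberTheory.EllipticCurves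
  Literature.NumberTheory.GaloisRepresentations

variable {F : Type u} [Field F] [NumberField F] (L : Type u) [Field L] [NumberField L] [Algebra F L]
  [Algebra.IsAlgebraic F L] [IsGalois F L] [(galRange (K := F) L).Normal] (W : WeierstrassCurve F)
  (ψ : geomPoints (W.baseChange L) →+ geomPoints W)
  (hψ : ∀ (n : galRange (K := F) L) (Q : geomPoints (W.baseChange L)), ψ (rangeToResGal (K := F) L n • Q) = n • ψ Q)
  (hψspec : ∀ P : geomPoints W, ψ (localPointsEquivGeomPoints W L (pointsMap W L P)) = P)

/-! ## §5′ The `g_*` form at the chosen embedding, general base -/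

include hψspec in
/-- **Finite places, every conjugate (general base `F`).** For `x ∈ Ш(E_L/L)`, a finite place `v` of `F` and every `g ∈ Γ_F`, the
conjugate `g_*` of the model class `res_{(rangeToResGal, ψ)} x` dies under the local restriction at the CHOSEN embedding `F̄ → (F_v)‾` on
`(resGal F_v)⁻¹(galRange L)` (§4 at `closureEmb ∘ g`, moved back by §1). [cite: NeukirchSchmidtWingberg2008, I.§5]
[cite: SerreGaloisCohomology1997, II.§1.1] -/
theorem resH1Hom_conjH1_model_eq_zero_adicCompletion (v : HeightOneSpectrum (𝓞 F)) (g : Field.absoluteGaloisGroup F)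
    (x : (W.baseChange L).galH1) (hx : x ∈ (W.baseChange L).sha) :
    resH1Hom (comapRestrict (galRange (K := F) L) (resGal (K := F) (v.adicCompletion F))) (pointsMap W (v.adicCompletion F))
      (smul_compat_comapRestrict (galRange (K := F) L) (resGal (K := F) (v.adicCompletion F))
        (pointsMap W (v.adicCompletion F)) (pointsMap_smul W (v.adicCompletion F)))
      (Literature.NumberTheory.EllipticCurves.conjH1 (galRange (K := F) L) (geomPoints W) g
        (resH1Hom (rangeToResGal (K := F) L) ψ hψ x)) = 0 := by
  have h := resH1Hom_model_eq_zero_adicCompletion L W ψ hψ hψspec v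
    ((closureEmb (K := F) (v.adicCompletion F)).comp
      ((show AlgebraicClosure F ≃ₐ[F] AlgebraicClosure F from g) : AlgebraicClosure F →ₐ[F] AlgebraicClosure F)) x hx
  exact (resH1Hom_resGalSubgroupOfEmb_comp_eq_zero_iff W (galRange (K := F) L)
    (closureEmb (K := F) (v.adicCompletion F)) _ (resH1Hom (rangeToResGal (K := F) L) ψ hψ x)).mp h

omit [NumberField F] in
include hψspec in
/-- **Infinite places, every conjugate (general base `F`).** [cite: NeukirchSchmidtWingberg2008, I.§5] [cite: SerreGaloisCohomology1997, II.§1.1] -/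
theorem resH1Hom_conjH1_model_eq_zero_infinitePlace (v : InfinitePlace F) (g : Field.absoluteGaloisGroup F)
    (x : (W.baseChange L).galH1) (hx : x ∈ (W.baseChange L).sha) :
    resH1Hom (comapRestrict (galRange (K := F) L) (resGal (K := F) v.Completion)) (pointsMap W v.Completion)
      (smul_compat_comapRestrict (galRange (K := F) L) (resGal (K := F) v.Completion)
        (pointsMap W v.Completion) (pointsMap_smul W v.Completion))
      (Literature.NumberTheory.EllipticCurves.conjH1 (galRange (K := F) L) (geomPoints W) g
        (resH1Hom (rangeToResGal (K := F) L) ψ hψ x)) = 0 := by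
  have h := resH1Hom_model_eq_zero_infinitePlace L W ψ hψ hψspec v
    ((closureEmb (K := F) v.Completion).comp
      ((show AlgebraicClosure F ≃ₐ[F] AlgebraicClosure F from g) : AlgebraicClosure F →ₐ[F] AlgebraicClosure F)) x hx
  exact (resH1Hom_resGalSubgroupOfEmb_comp_eq_zero_iff W (galRange (K := F) L)
    (closureEmb (K := F) v.Completion) _ (resH1Hom (rangeToResGal (K := F) L) ψ hψ x)).mp h

/-! ## §6′ ★ Corestriction maps `Ш(E_L/L)` into `Ш(E/F)`, general base -/

variable [Fintype (Field.absoluteGaloisGroup F ⧸ galRange (K := F) L)]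

include hψspec in
/-- **Local triviality of `cores (res_{(rangeToResGal, ψ)} x)` at a finite place of `F`**, `x ∈ Ш(E_L/L)` (Clark–Sharif + §5′).
[cite: ClarkSharif2010, §3.6 (last paragraph)] [cite: NeukirchSchmidtWingberg2008, I.§5] -/
theorem coresH1_model_mem_localRestrictionKer_adicCompletion (v : HeightOneSpectrum (𝓞 F))
    (x : (W.baseChange L).galH1) (hx : x ∈ (W.baseChange L).sha) :
    coresH1 (galRange (K := F) L) (isOpen_galRange (K := F) L) (resH1Hom (rangeToResGal (K := F) L) ψ hψ x) ∈
      W.localRestrictionKer (v.adicCompletion F) := by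
  haveI : Fintype (Field.absoluteGaloisGroup (v.adicCompletion F) ⧸
      (galRange (K := F) L).comap ((resGal (K := F) (v.adicCompletion F) :
        Field.absoluteGaloisGroup (v.adicCompletion F) →ₜ* Field.absoluteGaloisGroup F) :
          Field.absoluteGaloisGroup (v.adicCompletion F) →* Field.absoluteGaloisGroup F)) :=
    @Fintype.ofFinite _ (finite_quotientComap (galRange (K := F) L) _)
  rw [WeierstrassCurve.localRestrictionKer, resKer_eq_ker, AddMonoidHom.mem_ker]
  exact resH1Hom_coresH1_eq_zero (galRange (K := F) L) (resGal (K := F) (v.adicCompletion F))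
    (pointsMap W (v.adicCompletion F)) (pointsMap_smul W (v.adicCompletion F)) (isOpen_galRange (K := F) L)
    (resH1Hom (rangeToResGal (K := F) L) ψ hψ x) fun g ↦ resH1Hom_conjH1_model_eq_zero_adicCompletion L W ψ hψ hψspec v g x hx

include hψspec in
/-- **Local triviality of `cores (res_{(rangeToResGal, ψ)} x)` at an infinite place of `F`**, `x ∈ Ш(E_L/L)`.
[cite: ClarkSharif2010, §3.6 (last paragraph)] [cite: NeukirchSchmidtWingberg2008, I.§5] -/
theorem coresH1_model_mem_localRestrictionKer_infinitePlace (v : InfinitePlace F)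
    (x : (W.baseChange L).galH1) (hx : x ∈ (W.baseChange L).sha) :
    coresH1 (galRange (K := F) L) (isOpen_galRange (K := F) L) (resH1Hom (rangeToResGal (K := F) L) ψ hψ x) ∈
      W.localRestrictionKer v.Completion := by
  haveI : Fintype (Field.absoluteGaloisGroup v.Completion ⧸
      (galRange (K := F) L).comap ((resGal (K := F) v.Completion :
        Field.absoluteGaloisGroup v.Completion →ₜ* Field.absoluteGaloisGroup F) :
          Field.absoluteGaloisGroup v.Completion →* Field.absoluteGaloisGroup F)) :=
    @Fintype.ofFinite _ (finite_quotientComap (galRange (K := F) L) _)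
  rw [WeierstrassCurve.localRestrictionKer, resKer_eq_ker, AddMonoidHom.mem_ker]
  exact resH1Hom_coresH1_eq_zero (galRange (K := F) L) (resGal (K := F) v.Completion)
    (pointsMap W v.Completion) (pointsMap_smul W v.Completion) (isOpen_galRange (K := F) L)
    (resH1Hom (rangeToResGal (K := F) L) ψ hψ x) fun g ↦ resH1Hom_conjH1_model_eq_zero_infinitePlace L W ψ hψ hψspec v g x hx

include hψspec in
/-- ★ **CORESTRICTION MAPS `Ш(E_L/L)` INTO `Ш(E/F)` over any base number field.**  For `E = W/F`, a finite Galois `L/F`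
(`galRange L ≤ Γ_F` open, normal, of finite index), a model pair `(rangeToResGal, ψ)` (`ψ ∘ θ = id`) and `x ∈ Ш(E_L/L)`:
`cores (res_{(rangeToResGal, ψ)} x) ∈ Ш(E/F)` — locally trivial at every finite and infinite place of `F` (double-coset formula; Milne ADT
I Rem. 6.10, NSW I.§5).  For `F = ℚ`, `ψ = θ⁻¹` this is `coresH1_galH1Model_mem_sha`.  UNCONDITIONAL; BSD is NOT proved by this.
[cite: MilneADT2006, I.§6 Rem. 6.10] [cite: NeukirchSchmidtWingberg2008, I.§5] [cite: ClarkSharif2010, §3.6] -/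
theorem coresH1_model_mem_sha (x : (W.baseChange L).galH1) (hx : x ∈ (W.baseChange L).sha) :
    coresH1 (galRange (K := F) L) (isOpen_galRange (K := F) L) (resH1Hom (rangeToResGal (K := F) L) ψ hψ x) ∈ W.sha := by
  rw [WeierstrassCurve.mem_sha_iff]
  exact ⟨fun v ↦ coresH1_model_mem_localRestrictionKer_adicCompletion L W ψ hψ hψspec v x hx,
    fun v ↦ coresH1_model_mem_localRestrictionKer_infinitePlace L W ψ hψ hψspec v x hx⟩

end Summit.BirchSwinnertonDyer.BirchSwinnertonDyer.Theorems.GenusExact.ShaCores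

end
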